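/-
COR-CM (cells pub-hodgecm / pub-hodgecm2, stage 2 of the Hodge ladder) — TRANSPOSITION SURGE, item (vi) sub-binder S2 / (vi-2)
`supply`, TEAM hCMisogE (coordinator ruling «HODGE: FINISH AS FAST AS POSSIBLE» 2026-08-21T18:44:30Z (1); pin-2's BRIEF
`HOME/pinning/hcmisog/BRIEF.md` §1 (G); hcmisog-lead decision D5′ 19:26Z; pub-hodgecm2 lead staging 18:45:07Z (1); WAVE 2 of hcmisog-lead 19:37:42Z; path under the lead's blanket `Transposition/Item6*` pre-ACK).  Seat prover-pub-hodgecm2-hcmisog-glue-0 = (G) GLUE, ONE writer of this path.  Theorems only: no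
definition, no instance, no named fact, nothing asserted, no proof holes.  Imported BY NAME, never edited or restated: hcmisog-isog-2's
`Item6PinMatchDef45.lean` ((I2) the identification, over b01's `Item6PinMatchDet.lean`, item6-p1's `Liu2021/Def45AsPrinted.lean` (I1),
tr-prover-1's `ReflexNormInducedType.lean` (N), binder-1's `CMTypeOfHodgeDeterminant.lean` (I2-H), b18's `AbelianVarietyCotangentHodge.lean`
(L2)), b17's `AbelianVarietyCotangentBaseChangeIso.lean` (L1b), TRACK 2's
`AbelianVarietyCotangentHodgeHolds.lean`.  FRAMING: HC_CM is NOT proved.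
-/
import Summits.HodgeConjecture.CorCM.B01.Transposition.Item6PinMatchDef45
import Literature.AlgebraicGeometry.Motives.AbelianVarietyCotangentBaseChangeIso
import Literature.AlgebraicGeometry.HodgeTheory.AbelianVarietyCotangentHodgeHolds
import HarnessLib

/-!
# Item (vi) S2, CM side: the binder `hCMisogE` from the [Liu 2021, Def. 4.5 (2)] READING of the consumer's objects

The assembly's END display `Model.hc_cm_of_thm418AsPrinted_pinnedE_isog` (pin-3, `Transposition/Item6SupplyPinnedAssembly.lean`)
carries, at the E-RATIONAL pin `A_μ ⊗_{E,ι₁} ℂ := (Aμ₀ F ι₁ V Φ D_μ).baseChange ℂ` along `ι₁`, the CM-side binder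

  `hCMisogE` — «`A_μ ⊗_{E,ι₁} ℂ` is ISOGENOUS to a complex abelian variety with multiplication by `𝓞_{M_μ}` realising on `H¹_B` the
  type `Ψ̃_μ = inducedCMType e_μ (reflexCMType ι₁ Φ_μ id)`» (pin-2's `hCMisog`, `Item6PinMatch.lean`:352),

for consumer carriers `D F ι₁ V Φ : Thm418Data F⁺ F` (the data of [Liu2021] Thm. 4.18) and `Aμ₀ F ι₁ V Φ D_μ : AbelianVariety F`
(Liu's «`A_μ` is an abelian variety over `E`», Def. 4.5 (2), `FJcycle.tex` l. 1944–1946).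

This file DERIVES that binder — with EXACTLY its type — from
* ONE READING binder `hAμ`: for every object `D_μ` of the consumer's `𝒜(μ)`-carrier `(D F ι₁ V Φ).Obj` there is a CM datum
  `X = (A_μ, i_μ, λ_μ, r_μ) ∈ 𝒜(μ)` in the AS-PRINTED typing `Liu2021.Def45.CMDatum` (item6-p1, [Liu2021] Def. 4.5 (2) l. 1944–1958:
  `A_μ/E` REAL; `i_μ : M_μ → End_E(A_μ)_ℚ` a RATIONAL CM structure, l. 1947–1948; FIRST BULLET «for every `x ∈ M_μ`, the determinant
  of the action of `i_μ(x)` on the `E`-vector space `Lie_E(A_μ)` equals `η_μ(x)`», l. 1949–1950, typed on the cotangent space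
  `𝔪_e/𝔪_e² = Lie_E(A_μ)^∨` with `η_μ := η'_μ ∘ Nm_{M_μ/M'_μ}` DEFINED, Def. 4.5 (1) l. 1939–1942; bullets 2–4 as the ⟨CARRIER⟩
  components `C : Def45.Carriers`) WHOSE FIRST COMPONENT IS the pin's `Aμ₀ F ι₁ V Φ D_μ`;
and NO OTHER CM-side hypothesis: the Hodge comparison `cotangent_hodge10_comparison` (b18, (L2): «`H^{1,0}(B) ≅ T_e^*(B)`
`End`-equivariantly», [LangeBirkenhake1992 §1.1.5 (1.6), Cor. 1.1.7; Shimura1998 §2.6–2.8]) is TRACK 2's KERNEL theorem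
`cotangent_hodge10_comparison_holds` (hcmisog-lie-2 / hcmisog-lie-1 / tr-prover-1), used BY NAME.

KERNEL, BY NAME: hcmisog-isog-2's identification `Model.exists_isogeny_isCMTypeRealisation_baseChange_of_det45` (the CM type of
`A_μ ⊗_E ℂ` over `M_μ` is `Ψ̃_μ`, from the first bullet through the cotangent space, base change and the Hodge comparison; itself over
b01's `Model.exists_isogeny_isCMTypeRealisation_baseChange_of_detInvariant`, binder-1's `exists_isogeny_isCMTypeRealisation_of_det_complexAction`
[Shimura1998 §5.2, §7.1 Prop. 7], item6-p1's `Def45.eta` / `Def45.apply_eta_eq_finprod_of_coe_eq`, tr-prover-1's (N)), with its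
base-change law `hdetBC` DISCHARGED by b17's KERNEL `AbelianVariety.det_cotangentMap_baseChange` ([GortzWedhorn2020 Rem. 6.12], proved).  The universe fact behind
the shape (`Thm418Data.Obj : Type` while `Def45.CMDatum … : Type 1`, so `Obj := CMDatum` cannot be substituted into the landed
carriers) is why the datum enters as a READING of the consumer's objects and not as the carrier itself (hcmisog-lead D5′; NAMES-G).

STRENGTH / READING (for the red team and the T5 seat): `hAμ ⟹ hCMisogE` at every guarded face; no degree- or face-specific
input; `hAμ` is NOT inhabited here — its inhabitation at a general face is [Liu2021] Prop. 4.6 (1) (l. 1966–1969, «𝒜(μ) is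
nonempty») READ on the as-printed typing, exactly the content of the display's `hObj` plus the identification of the consumer's
objects with Liu's; the Hodge comparison and the cotangent base change are tree theorems used by name.  NOT claimed:
that Liu's `X_K` / `A_K` / `A_μ` are constructed; that `hComp` / `hD` are inhabited; that HC_CM is proved.

References: Y. Liu, *Fourier–Jacobi cycles and arithmetic relative trace formula*, Camb. J. Math. 9 (2021) = arXiv:2102.11518
(`FJcycle.tex` md5 6db49a74122d): Def. 4.3 (2) l. 1914–1921, §4.1 l. 1924–1928, Def. 4.5 l. 1936–1964, Prop. 4.6 (1) l. 1966–1969,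
Thm. 4.18 l. 2232–2245; G. Shimura, *Abelian Varieties with Complex Multiplication and Modular Functions* (1998) §5.2, §7.1 Prop. 7;
H. Lange, Ch. Birkenhake, *Complex Abelian Varieties* (1992) §1.1; U. Görtz, T. Wedhorn, *Algebraic Geometry I* (2020) Rem. 6.12.
-/

noncomputable section

open scoped TensorProduct

namespace Summit.HodgeConjecture.CorCM.Model

open CategoryTheory NumberField
open Literature.AlgebraicGeometry.Motives
open Literature.AlgebraicGeometry.HodgeTheory
open Literature.AlgebraicGeometry.ComplexMultiplication (IsCMTypeRealisation)
open Literature.NumberTheory.ComplexMultiplication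
open Literature.NumberTheory.Automorphic
open Literature.NumberTheory.Automorphic.IdeleClassGroup
open Literature.NumberTheory.Automorphic.PicardCM
open Literature.NumberTheory.Automorphic.Liu2021

section Reading

/-- **`hCMisogE` from the Def. 4.5 (2) READING of the consumer's objects** (TEAM hCMisogE glue, decision D5′).  Carriers: `D`
(the data of [Liu2021] Thm. 4.18, l. 2053–2074), `Aμ₀` («`A_μ` is an abelian variety over `E`», Def. 4.5 (2) l. 1944–1946) — both
EXACTLY as in the assembly's display — and `C` (the ⟨CARRIER⟩ components of Def. 4.5 (2) that the tree cannot state: bullet 2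
«CM character = `μ^{alg}`» l. 1952, `λ_μ` l. 1953–1955, `r_μ` l. 1955–1958; `Def45.Carriers`, never instantiated here).  Binders:
* `hAμ` — the READING «for every object `D_μ` of the consumer's `𝒜(μ)`-carrier there is a CM datum
  `X = (A_μ, i_μ, λ_μ, r_μ) ∈ 𝒜(μ)` in the as-printed typing `Def45.CMDatum` ([Liu2021] Def. 4.5 (2), l. 1944–1958: `A_μ/E` REAL,
  `i_μ : M_μ → End_E(A_μ)_ℚ` RATIONAL, first bullet «the determinant of the action of `i_μ(x)` on the `E`-vector space `Lie_E(A_μ)`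
  equals `η_μ(x)`» typed on `𝔪_e/𝔪_e²` with `η_μ` DEFINED, Def. 4.5 (1) l. 1939–1942) whose first component IS the pin's `A_μ`»,
  guarded to Galois CM `F`, `6 ≤ [F:ℚ]`, `ι₁ ∈ Φ` (the typing `Def45.CMDatum (AlgHom.id ℚ F) ι₁ …` needs `IsGalois ℚ F`);
and NO other CM-side hypothesis (the Hodge comparison `cotangent_hodge10_comparison` is TRACK 2's kernel theorem
`cotangent_hodge10_comparison_holds`, used by name).
Conclusion: EXACTLY the binder `hCMisogE` of `Model.hc_cm_of_thm418AsPrinted_pinnedE_isog` (= pin-2's `hCMisog`,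
`Item6PinMatch.lean`:352, at the E-rational pin `(Aμ₀ …).baseChange ℂ` along `ι₁`).  PROOF: destructure the datum `X`, `subst` its
first component (a local variable — no transport of varieties in the statement), and apply the (I2) identification
`Model.exists_isogeny_isCMTypeRealisation_baseChange_of_cmDatum` (hcmisog-isog-2) to `X`, with its object-independent base-change law
`hdetBC` DISCHARGED by b17's kernel `AbelianVariety.det_cotangentMap_baseChange` ((L1b)) and its Hodge-comparison hypothesis by
TRACK 2's `cotangent_hodge10_comparison_holds`.  HC_CM is NOT proved; `hAμ`
is not inhabited here (its inhabitation at a general face is [Liu2021] Prop. 4.6 (1), l. 1966–1969, read on the as-printed typing).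
[cite: Liu2021, Def. 4.5 (1)–(2) (FJcycle.tex l. 1936–1958) and Prop. 4.6 (1) (l. 1966–1969)] -/
theorem hCMisogE_of_def45Reading
    (D : ∀ (F : CMField) (ι₁ : F →+* ℂ) (_ : HermSpace3 F ι₁) (_ : CMType F), Thm418Data (maximalRealSubfield F) F)
    (Aμ₀ : ∀ (F : CMField) (ι₁ : F →+* ℂ) (V : HermSpace3 F ι₁) (Φ : CMType F), (D F ι₁ V Φ).Obj → AbelianVariety F)
    (C : ∀ (F : CMField) (ι₁ : F →+* ℂ) (V : HermSpace3 F ι₁) (Φ : CMType F), Def45.Carriers F (D F ι₁ V Φ).μ)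
    (hAμ : ∀ (F : CMField) [IsGalois ℚ F], 6 ≤ Module.finrank ℚ F → ∀ (Φ : CMType F) (ι₁ : F →+* ℂ), ι₁ ∈ Φ.1 →
      ∀ (V : HermSpace3 F ι₁) (Dμ : (D F ι₁ V Φ).Obj),
        ∃ X : Def45.CMDatum (AlgHom.id ℚ F) ι₁ (D F ι₁ V Φ).isConjugateSymplectic (D F ι₁ V Φ).hasWeight_one
          (C F ι₁ V Φ), X.A = Aμ₀ F ι₁ V Φ Dμ) :
    ∀ (F : CMField) [IsGalois ℚ F], 6 ≤ Module.finrank ℚ F → ∀ (Φ : CMType F) (ι₁ : F →+* ℂ), ι₁ ∈ Φ.1 →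
      ∀ (V : HermSpace3 F ι₁) (Dμ : (D F ι₁ V Φ).Obj),
        haveI := (D F ι₁ V Φ).isConjugateSymplectic.numberField_muAlgValueField
        ∀ e : reflexField ℚ F (algValuedIn ι₁ (D F ι₁ V Φ).cmType.1) →+* muAlgValueField F (D F ι₁ V Φ).μ,
          (∀ k : reflexField ℚ F (algValuedIn ι₁ (D F ι₁ V Φ).cmType.1),
            ((e k : muAlgValueField F (D F ι₁ V Φ).μ) : ℂ) = ι₁ k) →
          ∃ (B : AbelianVariety ℂ) (g : (letI := ι₁.toAlgebra; (Aμ₀ F ι₁ V Φ Dμ).baseChange ℂ) ⟶ B),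
            AbelianVariety.IsIsogeny g ∧
            ∃ (ιB : 𝓞 (muAlgValueField F (D F ι₁ V Φ).μ) →+* End B)
              (θB : muAlgValueField F (D F ι₁ V Φ).μ →+* Module.End ℂ (complexBetti B.X 1)),
              IsCMTypeRealisation (inducedCMType e (reflexCMType ι₁ (D F ι₁ V Φ).cmType (AlgHom.id ℚ F))) B ιB θB := by
  intro F _ h6 Φ ι₁ hι V Dμ e he
  obtain ⟨X, hX⟩ := hAμ F h6 Φ ι₁ hι V Dμ
  obtain ⟨A, i, hfr, hdet, hc, hp⟩ := X
  change A = Aμ₀ F ι₁ V Φ Dμ at hX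
  subst hX
  exact exists_isogeny_isCMTypeRealisation_baseChange_of_cmDatum (hw := (D F ι₁ V Φ).hasWeight_one)
    cotangent_hodge10_comparison_holds
    (fun _ _ L _ _ _ u => AbelianVariety.det_cotangentMap_baseChange L u) ι₁ ⟨_, i, hfr, hdet, hc, hp⟩ e he

end Reading

end Summit.HodgeConjecture.CorCM.Model

end
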